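import Summits.KontsevichZagierPeriods.KontsevichZagierPeriods.Theorems.HyperbolicBlochOffTetraSectorKernelStubIdealSpxClassAux

/-!
# `OffTetraSectorKernel` (stmt-KontsevichZagierPeriods-10557) — line `odd-hyperbolic-ladder`
(skeleton v5), stub `stub_meshCover`

Upper half-space model of `ℍ³`, `p : Fin 3 → ℝ`, shadow `q = (p 0, p 1)`, height `t = p 2`; paraboloid
lift `Ql p = (|p|², p₀, p₁, 1)`; `Spx v = {p | 0 < p₂ ∧ ∀ a, 0 < det v · det (v[a := Ql p])}` is the open
lifted simplex of four rows `v`. For `M, δ > 0` we mesh the solid cylinder `{|q| < M, t > δ}` by finitely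
many IDEAL tetrahedra with apex `∞`: take `N = ⌈M⌉`, `K = ⌈1/δ⌉`, side `h = 1/K ≤ δ`, the grid
`g k = k h − N` (`0 ≤ k ≤ 2NK`) of the square `[−N, N]²`, and cut every grid cell
`[g i, g i + h] × [g j, g j + h]` by its diagonal into a lower and an upper right triangle. The rows of
the tetrahedron over a triangle are the lift `(1, 0, 0, 0)` of `∞` and the lifts `(c₀² + c₁², c₀, c₁, 1)`
of its three (rational) corners (the opaque `rows`, section `Rows`); they are real-algebraic, normalised null
(`x² + y² = n m`, `m ≥ 0`, `n + m > 0`) and have determinant `h² ≠ 0` (twice the area).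
Expanding the five `4 × 4` determinants (`Matrix.det_fin_four`) identifies the tetrahedron with the
chimney over the open triangle above its circum-hemisphere (the hemisphere over the hypotenuse):
`Spx = {t > 0, q ∈ τ°, (q₀ − a)(q₀ − a − h) + (q₁ − b)(q₁ − b − h) + t² > 0}` (`mesh_mem_lo`,
`mesh_mem_up`). Hence distinct tetrahedra are disjoint (distinct open triangles are), and a point of the
cylinder off the vertical walls over the grid lines and diagonals (countably many planes, Lebesgue-null by
the landed `FiveTerm.volume_quadric_eq_zero`) lies in the tetrahedron over the triangle containing its
shadow, because `t > δ ≥ h` exceeds the circumradius `h/√2`. The family is re-indexed by `Fin m` along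
`Fintype.equivFin`.

References: J. L. Dupont, C.-H. Sah, *Scissors congruences II*, J. Pure Appl. Algebra 25 (1982), §3
(ideal triangulations of polyhedra with a vertex at `∞`); M. Kontsevich, D. Zagier, *Periods* (2001),
§1.2 (rule (1a): cutting a domain along null walls).
-/

noncomputable section

open Set MeasureTheory
open Literature.NumberTheory.Transcendental

namespace Summit.KontsevichZagierPeriods.HyperbolicBloch.OffTetraSectorKernel

/-! ## The two mesh tetrahedra over a grid cell -/

section Rows

/-! The rows `rows u a b h` of the two mesh tetrahedra over the cell `[a, a + h] × [b, b + h]` (an opaque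
function pinned by its equation `hrows`): the lift `(1, 0, 0, 0)` of `∞` and the lifts `(c₀² + c₁², c₀, c₁, 1)`
of the three corners, in counter-clockwise order, of the lower (`u = false`: `(a, b)`, `(a + h, b)`,
`(a + h, b + h)`) or the upper (`u = true`: `(a, b)`, `(a + h, b + h)`, `(a, b + h)`) right triangle cut
out by the diagonal. -/

variable (rows : Bool → ℝ → ℝ → ℝ → Fin 4 → Fin 4 → ℝ)
  (hrows : ∀ u a b h, rows u a b h =
    if u then ![![1, 0, 0, 0], ![a ^ 2 + b ^ 2, a, b, 1], ![(a + h) ^ 2 + (b + h) ^ 2, a + h, b + h, 1],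
      ![a ^ 2 + (b + h) ^ 2, a, b + h, 1]]
    else ![![1, 0, 0, 0], ![a ^ 2 + b ^ 2, a, b, 1], ![(a + h) ^ 2 + b ^ 2, a + h, b, 1],
      ![(a + h) ^ 2 + (b + h) ^ 2, a + h, b + h, 1]])
include hrows

/-- The mesh rows over a rational cell are the casts of rational rows. [folklore] -/
theorem mesh_rows_cast (u : Bool) (a b h : ℚ) :
    rows u a b h = fun r c => (((if u then ![![1, 0, 0, 0], ![a ^ 2 + b ^ 2, a, b, 1],
        ![(a + h) ^ 2 + (b + h) ^ 2, a + h, b + h, 1], ![a ^ 2 + (b + h) ^ 2, a, b + h, 1]]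
      else ![![1, 0, 0, 0], ![a ^ 2 + b ^ 2, a, b, 1], ![(a + h) ^ 2 + b ^ 2, a + h, b, 1],
        ![(a + h) ^ 2 + (b + h) ^ 2, a + h, b + h, 1]] : Fin 4 → Fin 4 → ℚ) r c : ℚ) : ℝ) := by
  rw [hrows]
  funext r c
  cases u <;> fin_cases r <;> fin_cases c <;> simp

/-- The entries of the mesh rows over a rational cell are real-algebraic. [folklore] -/
theorem mesh_alg (u : Bool) (a b h : ℚ) (r c : Fin 4) : IsAlgebraic ℚ (rows u a b h r c) := by
  rw [mesh_rows_cast rows hrows]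
  exact isAlgebraic_rat ℚ _

/-- The mesh rows are normalised null future rows: `x² + y² = n m`, `m ≥ 0`, `n + m > 0` (lifts of `∞`
and of floor points). [folklore] -/
theorem mesh_rows_null (u : Bool) (a b h : ℝ) (r : Fin 4) :
    rows u a b h r 1 ^ 2 + rows u a b h r 2 ^ 2 = rows u a b h r 0 * rows u a b h r 3 ∧
      0 ≤ rows u a b h r 3 ∧ 0 < rows u a b h r 0 + rows u a b h r 3 := by
  rw [hrows]
  cases u <;> fin_cases r <;> simp <;> positivity

/-- The determinant of the mesh rows is `h²`, twice the area of the triangle. [folklore] -/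
theorem mesh_rows_det (u : Bool) (a b h : ℝ) : (Matrix.of (rows u a b h)).det = h ^ 2 := by
  rw [hrows]
  cases u <;> rw [Matrix.det_fin_four] <;> simp <;> ring

/-- Row `0` (the vertex `∞`) replaced by the lift of `p`: `h²` times the power of `p` with respect to
the circum-sphere of the triangle (centre the midpoint of the hypotenuse, radius `h/√2`). [folklore] -/
theorem mesh_rows_det0 (u : Bool) (a b h : ℝ) (p : Fin 3 → ℝ) :
    ((Matrix.of (rows u a b h)).updateRow 0 ![p 0 ^ 2 + p 1 ^ 2 + p 2 ^ 2, p 0, p 1, 1]).det =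
      h ^ 2 * ((p 0 - a) * (p 0 - a - h) + (p 1 - b) * (p 1 - b - h) + p 2 ^ 2) := by
  rw [hrows]
  cases u <;> rw [Matrix.det_fin_four] <;> simp [Matrix.updateRow_apply] <;> ring

/-- Lower triangle, row `1` replaced: the edge `x = a + h`. [folklore] -/
theorem mesh_rows_det1_lo (a b h : ℝ) (p : Fin 3 → ℝ) :
    ((Matrix.of (rows false a b h)).updateRow 1 ![p 0 ^ 2 + p 1 ^ 2 + p 2 ^ 2, p 0, p 1, 1]).det =
      h * (a + h - p 0) := by
  rw [hrows, Matrix.det_fin_four]; simp [Matrix.updateRow_apply]; ring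

/-- Lower triangle, row `2` replaced: the diagonal. [folklore] -/
theorem mesh_rows_det2_lo (a b h : ℝ) (p : Fin 3 → ℝ) :
    ((Matrix.of (rows false a b h)).updateRow 2 ![p 0 ^ 2 + p 1 ^ 2 + p 2 ^ 2, p 0, p 1, 1]).det =
      h * ((p 0 - a) - (p 1 - b)) := by
  rw [hrows, Matrix.det_fin_four]; simp [Matrix.updateRow_apply]; ring

/-- Lower triangle, row `3` replaced: the edge `y = b`. [folklore] -/
theorem mesh_rows_det3_lo (a b h : ℝ) (p : Fin 3 → ℝ) :
    ((Matrix.of (rows false a b h)).updateRow 3 ![p 0 ^ 2 + p 1 ^ 2 + p 2 ^ 2, p 0, p 1, 1]).det =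
      h * (p 1 - b) := by
  rw [hrows, Matrix.det_fin_four]; simp [Matrix.updateRow_apply]; ring

/-- Upper triangle, row `1` replaced: the edge `y = b + h`. [folklore] -/
theorem mesh_rows_det1_up (a b h : ℝ) (p : Fin 3 → ℝ) :
    ((Matrix.of (rows true a b h)).updateRow 1 ![p 0 ^ 2 + p 1 ^ 2 + p 2 ^ 2, p 0, p 1, 1]).det =
      h * (b + h - p 1) := by
  rw [hrows, Matrix.det_fin_four]; simp [Matrix.updateRow_apply]; ring

/-- Upper triangle, row `2` replaced: the edge `x = a`. [folklore] -/
theorem mesh_rows_det2_up (a b h : ℝ) (p : Fin 3 → ℝ) :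
    ((Matrix.of (rows true a b h)).updateRow 2 ![p 0 ^ 2 + p 1 ^ 2 + p 2 ^ 2, p 0, p 1, 1]).det =
      h * (p 0 - a) := by
  rw [hrows, Matrix.det_fin_four]; simp [Matrix.updateRow_apply]; ring

/-- Upper triangle, row `3` replaced: the diagonal. [folklore] -/
theorem mesh_rows_det3_up (a b h : ℝ) (p : Fin 3 → ℝ) :
    ((Matrix.of (rows true a b h)).updateRow 3 ![p 0 ^ 2 + p 1 ^ 2 + p 2 ^ 2, p 0, p 1, 1]).det =
      h * ((p 1 - b) - (p 0 - a)) := by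
  rw [hrows, Matrix.det_fin_four]; simp [Matrix.updateRow_apply]; ring

/-! ## The mesh tetrahedra as sets -/

/-- **The lower mesh tetrahedron as a set**: the chimney over the open lower triangle above the
circum-hemisphere. [cite: DupontSah1982, §3] -/
theorem mesh_mem_lo (Ql : (Fin 3 → ℝ) → Fin 4 → ℝ) (hQl : ∀ p, Ql p = ![p 0 ^ 2 + p 1 ^ 2 + p 2 ^ 2, p 0, p 1, 1])
    (Spx : (Fin 4 → Fin 4 → ℝ) → Set (Fin 3 → ℝ))
    (hSpx : ∀ v, Spx v = {p | 0 < p 2 ∧ ∀ a, 0 < (Matrix.of v).det * ((Matrix.of v).updateRow a (Ql p)).det})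
    {a b h : ℝ} (hh : 0 < h) (p : Fin 3 → ℝ) :
    p ∈ Spx (rows false a b h) ↔ 0 < p 2 ∧ p 0 < a + h ∧ p 1 - b < p 0 - a ∧ b < p 1 ∧
      0 < (p 0 - a) * (p 0 - a - h) + (p 1 - b) * (p 1 - b - h) + p 2 ^ 2 := by
  have hh2 : 0 < h ^ 2 := by positivity
  rw [hSpx, mem_setOf_eq, hQl, mesh_rows_det rows hrows]
  constructor
  · rintro ⟨h2, hall⟩
    have h0 := (mul_pos_iff_of_pos_left hh2).1 (hall 0)
    have h1 := (mul_pos_iff_of_pos_left hh2).1 (hall 1)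
    have h2' := (mul_pos_iff_of_pos_left hh2).1 (hall 2)
    have h3 := (mul_pos_iff_of_pos_left hh2).1 (hall 3)
    rw [mesh_rows_det0 rows hrows, mul_pos_iff_of_pos_left hh2] at h0
    rw [mesh_rows_det1_lo rows hrows, mul_pos_iff_of_pos_left hh, sub_pos] at h1
    rw [mesh_rows_det2_lo rows hrows, mul_pos_iff_of_pos_left hh, sub_pos] at h2'
    rw [mesh_rows_det3_lo rows hrows, mul_pos_iff_of_pos_left hh, sub_pos] at h3
    exact ⟨h2, h1, h2', h3, h0⟩
  · rintro ⟨h2, h1, h2', h3, h0⟩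
    refine ⟨h2, fun i => ?_⟩
    match i with
    | 0 => rw [mesh_rows_det0 rows hrows]; positivity
    | 1 => rw [mesh_rows_det1_lo rows hrows]; exact mul_pos hh2 (mul_pos hh (sub_pos.2 h1))
    | 2 => rw [mesh_rows_det2_lo rows hrows]; exact mul_pos hh2 (mul_pos hh (sub_pos.2 h2'))
    | 3 => rw [mesh_rows_det3_lo rows hrows]; exact mul_pos hh2 (mul_pos hh (sub_pos.2 h3))

/-- **The upper mesh tetrahedron as a set**: the chimney over the open upper triangle above the
circum-hemisphere. [cite: DupontSah1982, §3] -/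
theorem mesh_mem_up (Ql : (Fin 3 → ℝ) → Fin 4 → ℝ) (hQl : ∀ p, Ql p = ![p 0 ^ 2 + p 1 ^ 2 + p 2 ^ 2, p 0, p 1, 1])
    (Spx : (Fin 4 → Fin 4 → ℝ) → Set (Fin 3 → ℝ))
    (hSpx : ∀ v, Spx v = {p | 0 < p 2 ∧ ∀ a, 0 < (Matrix.of v).det * ((Matrix.of v).updateRow a (Ql p)).det})
    {a b h : ℝ} (hh : 0 < h) (p : Fin 3 → ℝ) :
    p ∈ Spx (rows true a b h) ↔ 0 < p 2 ∧ p 1 < b + h ∧ a < p 0 ∧ p 0 - a < p 1 - b ∧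
      0 < (p 0 - a) * (p 0 - a - h) + (p 1 - b) * (p 1 - b - h) + p 2 ^ 2 := by
  have hh2 : 0 < h ^ 2 := by positivity
  rw [hSpx, mem_setOf_eq, hQl, mesh_rows_det rows hrows]
  constructor
  · rintro ⟨h2, hall⟩
    have h0 := (mul_pos_iff_of_pos_left hh2).1 (hall 0)
    have h1 := (mul_pos_iff_of_pos_left hh2).1 (hall 1)
    have h2' := (mul_pos_iff_of_pos_left hh2).1 (hall 2)
    have h3 := (mul_pos_iff_of_pos_left hh2).1 (hall 3)
    rw [mesh_rows_det0 rows hrows, mul_pos_iff_of_pos_left hh2] at h0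
    rw [mesh_rows_det1_up rows hrows, mul_pos_iff_of_pos_left hh, sub_pos] at h1
    rw [mesh_rows_det2_up rows hrows, mul_pos_iff_of_pos_left hh, sub_pos] at h2'
    rw [mesh_rows_det3_up rows hrows, mul_pos_iff_of_pos_left hh, sub_pos] at h3
    exact ⟨h2, h1, h2', h3, h0⟩
  · rintro ⟨h2, h1, h2', h3, h0⟩
    refine ⟨h2, fun i => ?_⟩
    match i with
    | 0 => rw [mesh_rows_det0 rows hrows]; positivity
    | 1 => rw [mesh_rows_det1_up rows hrows]; exact mul_pos hh2 (mul_pos hh (sub_pos.2 h1))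
    | 2 => rw [mesh_rows_det2_up rows hrows]; exact mul_pos hh2 (mul_pos hh (sub_pos.2 h2'))
    | 3 => rw [mesh_rows_det3_up rows hrows]; exact mul_pos hh2 (mul_pos hh (sub_pos.2 h3))

/-- The shadow of a point of a mesh tetrahedron lies in the open cell, on the triangle's side of the
diagonal. [folklore] -/
theorem mesh_mem_box (Ql : (Fin 3 → ℝ) → Fin 4 → ℝ) (hQl : ∀ p, Ql p = ![p 0 ^ 2 + p 1 ^ 2 + p 2 ^ 2, p 0, p 1, 1])
    (Spx : (Fin 4 → Fin 4 → ℝ) → Set (Fin 3 → ℝ))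
    (hSpx : ∀ v, Spx v = {p | 0 < p 2 ∧ ∀ a, 0 < (Matrix.of v).det * ((Matrix.of v).updateRow a (Ql p)).det})
    {u : Bool} {a b h : ℝ} (hh : 0 < h) {p : Fin 3 → ℝ} (hp : p ∈ Spx (rows u a b h)) :
    a < p 0 ∧ p 0 < a + h ∧ b < p 1 ∧ p 1 < b + h ∧ (u = true → p 0 - a < p 1 - b) ∧
      (u = false → p 1 - b < p 0 - a) := by
  cases u
  · rw [mesh_mem_lo rows hrows Ql hQl Spx hSpx hh] at hp
    obtain ⟨-, h1, h2, h3, -⟩ := hp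
    exact ⟨by linarith, h1, h3, by linarith, fun h => absurd h (by decide), fun _ => h2⟩
  · rw [mesh_mem_up rows hrows Ql hQl Spx hSpx hh] at hp
    obtain ⟨-, h1, h2, h3, -⟩ := hp
    exact ⟨h2, by linarith, by linarith, h1, fun _ => h3, fun h => absurd h (by decide)⟩

end Rows

/-! ## The grid: indices, floors, null walls -/

/-- Two grid intervals `(i h − c, i h − c + h)` containing a common point coincide. [folklore] -/
theorem mesh_nat_eq {h x c : ℝ} (hh : 0 < h) {i i' : ℕ} (h1 : i * h - c < x) (h2 : x < i * h - c + h)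
    (h1' : i' * h - c < x) (h2' : x < i' * h - c + h) : i = i' := by
  have a1 : (i : ℝ) < i' + 1 := lt_of_mul_lt_mul_right (by linarith) hh.le
  have a2 : (i' : ℝ) < i + 1 := lt_of_mul_lt_mul_right (by linarith) hh.le
  have b1 : i < i' + 1 := by exact_mod_cast a1
  have b2 : i' < i + 1 := by exact_mod_cast a2
  omega

/-- The grid interval containing a point of `[−c, n h − c)`: index `⌊(x + c)/h⌋ < n`. [folklore] -/
theorem mesh_floor {h x c : ℝ} (hh : 0 < h) {n : ℕ} (h0 : 0 ≤ x + c) (hn : x + c < n * h) :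
    ∃ k : ℕ, k < n ∧ (k : ℝ) * h - c ≤ x ∧ x < k * h - c + h := by
  have hy : 0 ≤ (x + c) / h := div_nonneg h0 hh.le
  have e : (x + c) / h * h = x + c := div_mul_cancel₀ _ hh.ne'
  refine ⟨⌊(x + c) / h⌋₊, (Nat.floor_lt hy).2 (by rwa [div_lt_iff₀ hh]), ?_, ?_⟩
  · have := Nat.floor_le hy
    nlinarith
  · have := Nat.lt_floor_add_one ((x + c) / h)
    nlinarith

/-- A set contained in a vertical plane `β x + γ y = c` (`(β, γ) ≠ 0`) is Lebesgue-null
(`FiveTerm.volume_quadric_eq_zero` with vanishing quadratic part). [folklore] -/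
theorem mesh_plane_null (β γ c : ℝ) (h : β ≠ 0 ∨ γ ≠ 0) (A : Set (Fin 3 → ℝ))
    (hA : ∀ p ∈ A, β * p 0 + γ * p 1 = c) : volume A = 0 := by
  have h0 := FiveTerm.volume_quadric_eq_zero 0 β γ (-c) (by
    rintro ⟨-, hβ, hγ, -⟩
    exact h.elim (fun h' => h' hβ) (fun h' => h' hγ))
  refine measure_mono_null (fun p hp => ?_) h0
  have := hA p hp
  simp only [mem_setOf_eq]
  linarith

/-- The vertical walls over the grid lines and the diagonals (countably many planes) are Lebesgue-null.
[folklore] -/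
theorem mesh_grid_null (h c : ℝ) :
    volume ((⋃ k : ℕ, {p : Fin 3 → ℝ | p 0 = k * h - c}) ∪ (⋃ k : ℕ, {p : Fin 3 → ℝ | p 1 = k * h - c}) ∪
      ⋃ m : ℤ, {p : Fin 3 → ℝ | p 0 - p 1 = m * h}) = 0 := by
  refine measure_union_null (measure_union_null ?_ ?_) ?_
  · exact measure_iUnion_null fun k => mesh_plane_null 1 0 (k * h - c) (by simp) _ fun p hp => by
      simp only [mem_setOf_eq] at hp; linarith
  · exact measure_iUnion_null fun k => mesh_plane_null 0 1 (k * h - c) (by simp) _ fun p hp => by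
      simp only [mem_setOf_eq] at hp; linarith
  · exact measure_iUnion_null fun m => mesh_plane_null 1 (-1) (m * h) (by simp) _ fun p hp => by
      simp only [mem_setOf_eq] at hp; linarith

/-- Re-indexing a finite family of tetrahedra by `Fin m`. [folklore] -/
theorem mesh_transfer {ι : Type*} [Fintype ι] (Spx : (Fin 4 → Fin 4 → ℝ) → Set (Fin 3 → ℝ))
    (P : (Fin 4 → Fin 4 → ℝ) → Prop) (S : Set (Fin 3 → ℝ)) (ws : ι → Fin 4 → Fin 4 → ℝ)
    (h1 : ∀ i, P (ws i)) (h2 : ∀ i i', i ≠ i' → Spx (ws i) ∩ Spx (ws i') = ∅)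
    (h3 : volume (S \ ⋃ i, Spx (ws i)) = 0) :
    ∃ (m : ℕ) (vs : Fin m → Fin 4 → Fin 4 → ℝ), (∀ j, P (vs j)) ∧
      (∀ j j', j ≠ j' → Spx (vs j) ∩ Spx (vs j') = ∅) ∧ volume (S \ ⋃ j, Spx (vs j)) = 0 := by
  refine ⟨Fintype.card ι, fun j => ws ((Fintype.equivFin ι).symm j), fun j => h1 _,
    fun j j' hjj' => h2 _ _ fun e => hjj' ((Fintype.equivFin ι).symm.injective e), ?_⟩
  rwa [(Fintype.equivFin ι).symm.surjective.iUnion_comp (fun i => Spx (ws i))]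

/-! ## The stub -/

/-- STUB `stub_meshCover` (worker, v5): a grid of rational right triangles of circumradius `< δ` covering the disc of
radius `M`; the ideal tetrahedra with apex `∞` over them (`Spx` of the rows `(1,0,0,0)` and the lifted corners
`(|c|², c₀, c₁, 1)`: the chimney over the open triangle above its circum-hemisphere) are admissible, pairwise disjoint,
and cover `{|q| < M, t > δ}` up to the null vertical walls over the grid edges. [cite: DupontSah1982, §3] -/
theorem stub_meshCover :
    ∀ (Ql : (Fin 3 → ℝ) → Fin 4 → ℝ), (∀ p, Ql p = ![p 0 ^ 2 + p 1 ^ 2 + p 2 ^ 2, p 0, p 1, 1]) →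
    ∀ (Spx : (Fin 4 → Fin 4 → ℝ) → Set (Fin 3 → ℝ)),
      (∀ v, Spx v = {p | 0 < p 2 ∧ ∀ a, 0 < (Matrix.of v).det * ((Matrix.of v).updateRow a (Ql p)).det}) →
    ∀ (M δ : ℝ), 0 < M → 0 < δ →
      ∃ (m : ℕ) (vs : Fin m → Fin 4 → Fin 4 → ℝ),
        (∀ j, (∀ i c, IsAlgebraic ℚ (vs j i c)) ∧
          (∀ i, vs j i 1 ^ 2 + vs j i 2 ^ 2 = vs j i 0 * vs j i 3 ∧ 0 ≤ vs j i 3 ∧ 0 < vs j i 0 + vs j i 3) ∧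
          (Matrix.of (vs j)).det ≠ 0) ∧
        (∀ j j', j ≠ j' → Spx (vs j) ∩ Spx (vs j') = ∅) ∧
        volume ({p : Fin 3 → ℝ | p 0 ^ 2 + p 1 ^ 2 < M ^ 2 ∧ δ < p 2} \ ⋃ j, Spx (vs j)) = 0 := by
  intro Ql hQl Spx hSpx M δ hM hδ
  -- the parameters: `N = ⌈M⌉`, `K = ⌈1/δ⌉`, side `h = 1/K`, grid `g k = k h - N`, `n = 2 N K` cells per side
  obtain ⟨N, hMN⟩ : ∃ N : ℕ, M ≤ N := ⟨⌈M⌉₊, Nat.le_ceil M⟩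
  obtain ⟨K, hK, hKδ⟩ : ∃ K : ℕ, 0 < K ∧ 1 / δ ≤ K := ⟨⌈1 / δ⌉₊, Nat.ceil_pos.2 (by positivity), Nat.le_ceil _⟩
  have hK' : (0 : ℝ) < K := by exact_mod_cast hK
  obtain ⟨h, hh_def⟩ : ∃ h : ℝ, h = ((1 / K : ℚ) : ℝ) := ⟨_, rfl⟩
  obtain ⟨g, hg_def⟩ : ∃ g : ℕ → ℝ, ∀ k, g k = ((k / K - N : ℚ) : ℝ) := ⟨_, fun _ => rfl⟩
  have hhK : h = 1 / K := by rw [hh_def]; push_cast; ring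
  have hh : 0 < h := by rw [hhK]; positivity
  have hhδ : h ≤ δ := by rw [hhK]; exact (one_div_le hK' hδ).2 hKδ
  have hg : ∀ k, g k = k * h - N := by intro k; rw [hg_def, hhK]; push_cast; ring
  obtain ⟨n, hn⟩ : ∃ n : ℕ, n = 2 * N * K := ⟨_, rfl⟩
  have hnh : (n : ℝ) * h = 2 * N := by rw [hn, hhK]; push_cast; field_simp
  -- the rows of the two tetrahedra over a cell, and the family, indexed by (column, row, lower/upper)
  obtain ⟨rows, hrows⟩ : ∃ rows : Bool → ℝ → ℝ → ℝ → Fin 4 → Fin 4 → ℝ, ∀ u a b h, rows u a b h =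
      if u then ![![1, 0, 0, 0], ![a ^ 2 + b ^ 2, a, b, 1], ![(a + h) ^ 2 + (b + h) ^ 2, a + h, b + h, 1],
        ![a ^ 2 + (b + h) ^ 2, a, b + h, 1]]
      else ![![1, 0, 0, 0], ![a ^ 2 + b ^ 2, a, b, 1], ![(a + h) ^ 2 + b ^ 2, a + h, b, 1],
        ![(a + h) ^ 2 + (b + h) ^ 2, a + h, b + h, 1]] := ⟨_, fun _ _ _ _ => rfl⟩
  obtain ⟨ws, hws⟩ : ∃ ws : Fin n × Fin n × Bool → Fin 4 → Fin 4 → ℝ,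
      ∀ x, ws x = rows x.2.2 (g x.1) (g x.2.1) h := ⟨_, fun _ => rfl⟩
  refine mesh_transfer Spx (fun v => (∀ i c, IsAlgebraic ℚ (v i c)) ∧
      (∀ i, v i 1 ^ 2 + v i 2 ^ 2 = v i 0 * v i 3 ∧ 0 ≤ v i 3 ∧ 0 < v i 0 + v i 3) ∧ (Matrix.of v).det ≠ 0)
    _ ws ?_ ?_ ?_
  · -- admissible rows
    intro x
    rw [hws]
    refine ⟨fun r c => ?_, fun r => mesh_rows_null rows hrows _ _ _ _ r, ?_⟩
    · rw [hg_def, hg_def, hh_def]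
      exact mesh_alg rows hrows _ _ _ _ r c
    · rw [mesh_rows_det rows hrows]
      positivity
  · -- pairwise disjoint
    intro x x' hxx'
    refine eq_empty_of_forall_notMem fun p hp => hxx' ?_
    obtain ⟨hp, hp'⟩ := hp
    rw [hws] at hp hp'
    obtain ⟨h1, h2, h3, h4, h5⟩ := mesh_mem_box rows hrows Ql hQl Spx hSpx hh hp
    obtain ⟨h1', h2', h3', h4', h5'⟩ := mesh_mem_box rows hrows Ql hQl Spx hSpx hh hp'
    rw [hg] at h1 h2 h3 h4 h1' h2' h3' h4'
    have ei : x.1 = x'.1 := Fin.ext (mesh_nat_eq hh h1 h2 h1' h2')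
    have ej : x.2.1 = x'.2.1 := Fin.ext (mesh_nat_eq hh h3 h4 h3' h4')
    rw [ei, ej] at h5
    have eu : x.2.2 = x'.2.2 := by
      rcases Bool.eq_false_or_eq_true x.2.2 with hu | hu <;>
        rcases Bool.eq_false_or_eq_true x'.2.2 with hu' | hu' <;>
        first
          | exact hu.trans hu'.symm
          | exact absurd (h5.1 hu) (not_lt.2 (h5'.2 hu').le)
          | exact absurd (h5.2 hu) (not_lt.2 (h5'.1 hu').le)
    exact Prod.ext ei (Prod.ext ej eu)
  · -- cover up to the null walls
    refine measure_mono_null ?_ (mesh_grid_null h N)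
    rintro p ⟨⟨hpM, hpδ⟩, hpU⟩
    by_contra hZ
    simp only [mem_union, mem_iUnion, mem_setOf_eq, not_or, not_exists] at hZ
    obtain ⟨⟨hZ0, hZ1⟩, hZ2⟩ := hZ
    have hp0 : |p 0| < M := abs_lt_of_sq_lt_sq (by nlinarith [sq_nonneg (p 1)]) hM.le
    have hp1 : |p 1| < M := abs_lt_of_sq_lt_sq (by nlinarith [sq_nonneg (p 0)]) hM.le
    rw [abs_lt] at hp0 hp1
    obtain ⟨i, hi, hi1, hi2⟩ := mesh_floor hh (x := p 0) (c := N) (n := n) (by linarith) (by rw [hnh]; linarith)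
    obtain ⟨j, hj, hj1, hj2⟩ := mesh_floor hh (x := p 1) (c := N) (n := n) (by linarith) (by rw [hnh]; linarith)
    have hi1' : (i : ℝ) * h - N < p 0 := lt_of_le_of_ne hi1 fun e => hZ0 i e.symm
    have hj1' : (j : ℝ) * h - N < p 1 := lt_of_le_of_ne hj1 fun e => hZ1 j e.symm
    have hd : p 0 - (i * h - N) ≠ p 1 - (j * h - N) := by
      intro e
      refine hZ2 ((i : ℤ) - j) ?_
      push_cast
      linarith
    have hsq : h * h < p 2 * p 2 := mul_lt_mul'' (by linarith) (by linarith) hh.le hh.le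
    have hcirc : 0 < (p 0 - (i * h - N)) * (p 0 - (i * h - N) - h) + (p 1 - (j * h - N)) * (p 1 - (j * h - N) - h) +
        p 2 ^ 2 := by
      nlinarith [sq_nonneg (2 * (p 0 - (i * h - N)) - h), sq_nonneg (2 * (p 1 - (j * h - N)) - h)]
    apply hpU
    rcases lt_or_gt_of_ne hd with hlt | hgt
    · refine mem_iUnion.2 ⟨(⟨i, hi⟩, ⟨j, hj⟩, true), ?_⟩
      rw [hws, mesh_mem_up rows hrows Ql hQl Spx hSpx hh]
      simp only [hg]
      exact ⟨by linarith, hj2, hi1', hlt, hcirc⟩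
    · refine mem_iUnion.2 ⟨(⟨i, hi⟩, ⟨j, hj⟩, false), ?_⟩
      rw [hws, mesh_mem_lo rows hrows Ql hQl Spx hSpx hh]
      simp only [hg]
      exact ⟨by linarith, hi2, hgt, hj1', hcirc⟩

end Summit.KontsevichZagierPeriods.HyperbolicBloch.OffTetraSectorKernel

end
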